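import Summits.BirchSwinnertonDyer.Rank1Residual.X11b.Three.OpenInputTightLocus
import Summits.BirchSwinnertonDyer.Rank1Residual.X11b.ClassClosureTyped
import Summits.BirchSwinnertonDyer.Rank1Residual.X11b.RouteR1ControlCastella
import HarnessLib

/-!
# Class X11b, route p2: INSTANCES OF THE OPEN INPUT FROM THE CYCLOTOMIC SIDE — on the Locus (and on
# every semistable (ram) pair) a non-degenerate canonical `p`-adic height at `(E, p)` certifies the
# anticyclotomic inequality (IMC≥∘BDP)ᵗ at EVERY Heegner datum the route quantifies over; and route
# p2's control IDENTITY is Castella 2018 Thm. 2.3 on every SEMISTABLE pair (cell `b2b-bsdres`,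
# sub-cell `multr1-p2`, gen 21)

HONEST FRAMING (verbatim, cell `b2b-bsdres`, run/shared/lean/b2b/bsd-rank1-residual/): the goal of
the cell is to DELETE the COMBINATION-SHAPED residual classes for ALL analytic-rank `≤ 1` curves
over `ℚ` — "full BSD formula for every rank `≤ 1` curve in class `C`" assembled STRICTLY from
published theorems — so that the rank-`≤ 1` remainder becomes exactly the CONSTRUCTION-SHAPED
classes, which are TYPED (missing-input Props), NOT attempted; this is not "finishing BSD".
Research route `p2` for class X11b (`ClassX11b W p := r_an = 1 ∧ p ≠ 2 ∧ mult(p) ∧ irr(p)`,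
`Partition/Rows.lean`); no claim beyond the stated class and loci; nothing booked; X11b stays
CONSTRUCTION-SHAPED. THEOREMS ONLY (no definition, no named fact, no `sorry`). Every theorem is
CONDITIONAL on the published named facts it lists and on the per-pair input
`ClassClosure.RegulatorNonvanishingAt W p` (THE canonical `p`-adic height is non-degenerate: a finite
`p`-adic computation per pair; class-wide = Schneider's conjecture, OPEN; barrier file
`Literature/Barriers/BirchSwinnertonDyer/PAdicHeightNondegeneracyProofs.lean`). NOTHING here proves
THE open input as a class statement: these are per-pair INSTANCES.

## What this file does

THE open input of route p2, `P2OpenInputOnTreeAt W p` = (IMC≥∘BDP)ᵗ on the constructed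
`X_ac(E[p^∞])` at every odd-`d_K` Manin-good Heegner datum of the pair [at `p ∥ N`: Castella's
erratum (2.4) ⇐ Fouquet–Wan Thm. 4.41, UNREFEREED], is by the gen-18 TIGHTNESS theorem implied by
`BSD(E,p)` on the (ram) part of X11b, given the control IDENTITY `P2ControlOnTreeAt W p`
(`P2.openInputOnTreeAt_of_bsdp_of_ram`: rigidity — Gross–Zagier + Skinner 2016 Thm. C for the twist —
turns `BSD(E,p)` into STEP L, and the identity turns STEP L into (IMC≥∘BDP)ᵗ). Two new supplies:

* §1 `p2ControlOnTreeAt_of_thm23_of_semistable` — on every SEMISTABLE X11b pair the control identity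
  of route p2 IS the published Castella 2018 Thm. 2.3 (Literature fact
  `Castella2018.thm23_anticyclotomicControl`, typed by lit-cw gen 9; link
  `controlOnTreeAt_of_thm23_embAt`): at a p2 datum `rank_ℤ E(K) = 1` and `#Ш(E/K)[p^∞] < ∞` hold by
  Kolyvagin at the non-torsion Heegner point, and `p ∣ N` splits in `K`. (x11b3-p9's
  `p2ControlOnTreeAt_of_locus` gives the identity on the Locus `p ∤ ∏c` from cited cohomological
  facts; the two supplies overlap on semistable Locus pairs and together cover semistable ∪ Locus.)
* §2 `P2.openInputOnTreeAt_of_regulatorNonvanishing_of_locus` — on the Locus (`p ≥ 5`, (ram),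
  `p ∤ ∏c`; 2 093 111 ‖ 61 629 class-wide pairs): `RegulatorNonvanishingAt W p` ⟹ THE OPEN INPUT AT
  THE PAIR, from published + cited facts (the class-closure lever
  `ClassClosure.bsdp_of_leverLocus_of_regulatorNonvanishing` — Skinner 2016 Thm. A + Stein–Wuthrich
  Thm. 6.1 + Disegni Thm. 1 — gives `BSD(E,p)`; then tightness). `…_of_semistable` — the same on
  every SEMISTABLE (ram) pair at `p ≥ 5`, any Tamagawa numbers (control identity from §1).
  `P2.openInputOnTreeOddAt_of_regulatorNonvanishing_of_locus_nonsplit` — ANY ODD `p` (so `p = 3`),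
  non-split at `p`, on the Locus (x11b3-p9's facts-only odd tightness + the lever, whose non-split
  clause has no `p ≥ 5`): at `p = 3` this certifies team x11b3's `Three.StepLAt`-instances pair by
  pair from a `3`-adic regulator (REG3).
Reading: a CERTIFICATE ROAD to instances of an unrefereed Iwasawa-theoretic statement — every Locus
pair whose canonical `p`-adic height is checked non-degenerate satisfies (IMC≥∘BDP)ᵗ at all its p2
data; a numerical failure of STEP L at such a pair would contradict the PUBLISHED record (Kato,
Skinner A/C, Jones, Disegni, GZ, Kolyvagin), not merely the preprint. CONDITIONAL bookkeeping;
nothing booked; labels UNCHANGED; X11b stays CONSTRUCTION-SHAPED.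

References: [Castella2018] Thm. 2.3, Thm. 3.2; [Castella2018Erratum] (2.4); [Skinner2016PacificMC]
Thm. A, Thm. C; [SteinWuthrich2013] Thm. 6.1, §4.2; [Disegni2020] Thm. 1; [Wuthrich2014] Thm. 3;
[JetchevSkinnerWan2017] Thm. 3.3.1, §7.4.1; [GreenbergLNM1716] §3 Lemma 3.3; [Miller2011LMS] Def. 1.1.
-/

set_option autoImplicit false

noncomputable section

open scoped Classical MatrixGroups ModularForm

open CongruenceSubgroup WeierstrassCurve NumberField IsDedekindDomain Field
open Literature.NumberTheory.EllipticCurves Literature.NumberTheory.EllipticCurves.GreenbergSelmer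
  Literature.NumberTheory.EllipticCurves.ModularForms
  Literature.NumberTheory.EllipticCurves.Rank1Residual
  Literature.NumberTheory.EllipticCurves.Rank1Residual.Typed
  Literature.NumberTheory.EllipticCurves.Wuthrich2014
  Literature.NumberTheory.EllipticCurves.SteinWuthrich2013
  Literature.NumberTheory.EllipticCurves.Disegni2020
  Literature.NumberTheory.EllipticCurves.Skinner2016
  Literature.NumberTheory.EllipticCurves.Castella2018
  Literature.NumberTheory.GaloisRepresentations Literature.NumberTheory.GaloisCohomology
  Summit.BirchSwinnertonDyer.Rank1Residual.X11b.AcSelmer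
  Summit.BirchSwinnertonDyer.Rank1Residual.X11b.LocBridge

namespace Summit.BirchSwinnertonDyer.Rank1Residual.X11b

variable (W : WeierstrassCurve ℚ) [W.IsElliptic] [W.IsGloballyMinimal] (p : ℕ) [Fact p.Prime]

/-! ### §1. Route p2's control identity on SEMISTABLE pairs is Castella 2018 Thm. 2.3 -/

/-- **`P2ControlOnTreeAt W p` from Castella 2018 Thm. 2.3 on every SEMISTABLE pair.** For `W/ℚ`
globally minimal and semistable, the control IDENTITY demanded by route p2 at its data (X11b pair,
`p ≥ 5`, `ρ̄` onto, odd-`d_K` Manin-good Heegner datum with `L(E^{d_K},1) ≠ 0`, non-torsion Heegner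
point, anticyclotomic `κ`, degree-one `𝔭 ∣ p`, THE embedding `embAt`) HOLDS, granted the PUBLISHED
named fact `thm23_anticyclotomicControl` (`h23`) and Kolyvagin (`hKo`: `rank_ℤ E(K) = 1`,
`#Ш(E/K) < ∞` at the non-torsion Heegner point): `p ∣ N` splits in `K`
(`SatisfiesHeegnerHypothesis.of_dvd`), and the link `controlOnTreeAt_of_thm23_embAt` (lit-cw gen 9)
feeds the shape. CONDITIONAL on the named facts; nothing booked.
[cite: Castella2018, Thm. 2.3 (arXiv:1704.06608 p. 5), case p ∣ N] [cite: Kolyvagin1990, Thm. A]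
[cite: Gross1991, Thm. 1.3] -/
theorem p2ControlOnTreeAt_of_thm23_of_semistable (h23 : thm23_anticyclotomicControl)
    (hKo : ∀ (N : ℕ) [NeZero N] (W : WeierstrassCurve ℚ) (K : Type) [Field K] [NumberField K],
      kolyvagin N W K)
    (hsst : Semistable W) : P2ControlOnTreeAt W p := by
  intro N _ K _ _ Dt H ι P hX hp5 _ hN hK _ _ _ hHN _ hP _ hPinf κ hκ γ _ 𝔭 h𝔭 he hf
  obtain ⟨-, -, hmult, hirr⟩ := hX
  obtain ⟨hrk, hfinK⟩ := hKo N W K hK hHN ⟨Dt, H, ι, hP⟩ hPinf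
  haveI : Finite (W.baseChange K).sha := hfinK
  have hfin : Finite (AddCommGroup.primaryComponent (W.baseChange K).sha p) := inferInstance
  have hpN : p ∣ N := hN ▸ dvd_conductorNorm_of_mult hmult
  have hHp : SatisfiesHeegnerHypothesis p K := SatisfiesHeegnerHypothesis.of_dvd hpN hHN
  exact controlOnTreeAt_of_thm23_embAt h23 hsst hp5 hirr hmult hK hHp κ hκ γ 𝔭 h𝔭 he hf hrk hfin P
    hPinf

/-! ### §2. Instances of THE open input from a non-degenerate canonical `p`-adic height -/

/-- **On the Locus, `Reg_p(E) ≠ 0` certifies THE OPEN INPUT AT THE PAIR.** For `(E,p) ∈` X11b with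
`p ≥ 5`, a (ram) prime and `p ∤ ∏_ℓ c_ℓ(E)`: if THE canonical `p`-adic height is non-degenerate
(`ClassClosure.RegulatorNonvanishingAt W p`), then `P2OpenInputOnTreeAt W p` — (IMC≥∘BDP)ᵗ at every
p2 Heegner datum of the pair. Published binders: Gross–Zagier, Kolyvagin, Skinner 2016 Thm. C, GZK,
modularity (rigidity `BSD ⟹ STEP L`); Poitou–Tate for Selmer structures, Poitou–Tate for `Ш`, local
Euler characteristic, `cd_p ≤ 2` (x11b3-p9's control identity on the Locus); Skinner 2016 Thm. A,
Stein–Wuthrich 2013 Thm. 6.1 ×2 and §4.2 ×2, Disegni 2020 Thm. 1, modular parametrisation (the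
class-closure lever `BSD(E,p) ⇐ REG`). CONDITIONAL; an INSTANCE per pair, not the open input as a
class statement; nothing booked. [cite: Castella2018, Thm. 2.3 (p. 5), Thm. 3.2 (p. 9)]
[cite: Castella2018Erratum, (2.4) (p. 1)] [cite: Skinner2016PacificMC, Thm. A and Thm. C (§1)]
[cite: SteinWuthrich2013, Thm. 6.1 (p. 20), §4.2] [cite: Disegni2020, Thm. 1 (§1.2)]
[cite: JetchevSkinnerWan2017, Thm. 3.3.1, §7.4.1 (pp. 30–31)] -/
theorem P2.openInputOnTreeAt_of_regulatorNonvanishing_of_locus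
    -- rigidity (BSD ⟹ STEP L) and Kolyvagin
    (hGZ : ∀ (N : ℕ) [NeZero N] (W : WeierstrassCurve ℚ) (K : Type) [Field K] [NumberField K],
      gross_zagier N W K)
    (hKo : ∀ (N : ℕ) [NeZero N] (W : WeierstrassCurve ℚ) (K : Type) [Field K] [NumberField K],
      kolyvagin N W K)
    (hSk : Skinner2016.thmC_padicValRat_bsd_rank_zero)
    (hGZK : rank_eq_analyticRank_of_analyticRank_le_one) (hmod : hasEntireLFunction_rat)
    -- the control identity on the Locus (cited cohomological facts)
    (hPTs : ∀ (K : Type) [Field K] [NumberField K], poitouTate_selmerStructure_duality K)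
    (hPT2 : ∀ (K : Type) [Field K] [NumberField K], poitouTate_sha_tateDual K)
    (hEP : ∀ (K : Type) [Field K] [NumberField K] (v : HeightOneSpectrum (𝓞 K)),
      localEulerPoincareCharacteristic (v.adicCompletion K))
    (hcd : fieldCdLE_two_of_numberField)
    -- the class-closure lever
    (hSkA : thmA_charIdeal_multiplicative)
    (hJn : thm61_nonsplitMultiplicative) (hJs : thm61_splitMultiplicative)
    (hHn : exists_isMultCanonical) (hHs : exists_isSplitMultCanonical)
    (hD : thm1_padicBSD_rankOne_multiplicative) (hpar : nonempty_modularParametrizationData)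
    -- the pair: on the Locus, with the per-pair regulator input
    (hX : ClassX11b W p) (hp5 : 5 ≤ p) (hram : Ram W p) (htam : ¬ p ∣ W.tamagawaProduct)
    (hReg : ClassClosure.RegulatorNonvanishingAt W p) :
    P2OpenInputOnTreeAt W p :=
  P2.openInputOnTreeAt_of_bsdp_of_ram W p hGZ hKo hSk hGZK hmod
    (p2ControlOnTreeAt_of_locus W p hKo hPTs hPT2 hEP hcd hX hram htam) hram
    (ClassClosure.bsdp_of_leverLocus_of_regulatorNonvanishing W p hSkA hJn hJs hHn hHs hD hGZK hpar hX
      (ClassClosure.leverLocusAt_of_ram_of_five_le W p hram hp5) hReg)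

/-- **On every SEMISTABLE (ram) pair at `p ≥ 5` (any Tamagawa numbers), `Reg_p(E) ≠ 0` certifies
THE OPEN INPUT AT THE PAIR** — as `P2.openInputOnTreeAt_of_regulatorNonvanishing_of_locus`, with the
control identity from Castella 2018 Thm. 2.3 (§1, `h23`) instead of `p ∤ ∏c`. CONDITIONAL; an
instance per pair; nothing booked. [cite: Castella2018, Thm. 2.3 (p. 5), Thm. 3.2 (p. 9)]
[cite: Castella2018Erratum, (2.4) (p. 1)] [cite: Skinner2016PacificMC, Thm. A and Thm. C (§1)]
[cite: SteinWuthrich2013, Thm. 6.1 (p. 20), §4.2] [cite: Disegni2020, Thm. 1 (§1.2)] -/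
theorem P2.openInputOnTreeAt_of_regulatorNonvanishing_of_semistable
    (hGZ : ∀ (N : ℕ) [NeZero N] (W : WeierstrassCurve ℚ) (K : Type) [Field K] [NumberField K],
      gross_zagier N W K)
    (hKo : ∀ (N : ℕ) [NeZero N] (W : WeierstrassCurve ℚ) (K : Type) [Field K] [NumberField K],
      kolyvagin N W K)
    (hSk : Skinner2016.thmC_padicValRat_bsd_rank_zero)
    (hGZK : rank_eq_analyticRank_of_analyticRank_le_one) (hmod : hasEntireLFunction_rat)
    (h23 : thm23_anticyclotomicControl)
    (hSkA : thmA_charIdeal_multiplicative)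
    (hJn : thm61_nonsplitMultiplicative) (hJs : thm61_splitMultiplicative)
    (hHn : exists_isMultCanonical) (hHs : exists_isSplitMultCanonical)
    (hD : thm1_padicBSD_rankOne_multiplicative) (hpar : nonempty_modularParametrizationData)
    (hX : ClassX11b W p) (hp5 : 5 ≤ p) (hram : Ram W p) (hsst : Semistable W)
    (hReg : ClassClosure.RegulatorNonvanishingAt W p) :
    P2OpenInputOnTreeAt W p :=
  P2.openInputOnTreeAt_of_bsdp_of_ram W p hGZ hKo hSk hGZK hmod
    (p2ControlOnTreeAt_of_thm23_of_semistable W p h23 hKo hsst) hram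
    (ClassClosure.bsdp_of_leverLocus_of_regulatorNonvanishing W p hSkA hJn hJs hHn hHs hD hGZK hpar hX
      (ClassClosure.leverLocusAt_of_ram_of_five_le W p hram hp5) hReg)

/-- **ANY ODD `p` (so `p = 3`), NON-SPLIT at `p`, on the Locus: `Reg_p(E) ≠ 0` certifies the odd
open input `P2OpenInputOnTreeOddAt W p` AT THE PAIR** — x11b3-p9's facts-only odd tightness
`P2.openInputOnTreeOddAt_of_bsdp_of_locus_of_facts` composed with the class-closure lever, whose
non-split clause carries no `p ≥ 5` (Skinner 2016 Thm. A `p ≥ 3`, SW 6.1 `p ≠ 2`, Disegni Thm. 1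
non-split any `p`). At `p = 3`: on the 722 non-split (ram) Locus classes among the 1 684 TRUE-OPEN
X11b classes at `3` (rmap-3 g6), a `3`-adic regulator certificate (REG3) yields BOTH `BSD(E,3)`
(lever) AND an instance of team x11b3's `Three.StepLAt`-shaped open input at every p2 datum.
CONDITIONAL; an instance per pair; nothing booked. [cite: Skinner2016PacificMC, Thm. A and Thm. C (§1), footnote 1]
[cite: SteinWuthrich2013, Thm. 6.1 (p. 20), §4.2] [cite: Disegni2020, Thm. 1 (§1.2), Thm. 4 first bullet]
[cite: Castella2018, Thm. 2.3 (p. 5), Thm. 3.2 (p. 9)] [cite: JetchevSkinnerWan2017, Thm. 3.3.1, §7.4.1] -/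
theorem P2.openInputOnTreeOddAt_of_regulatorNonvanishing_of_locus_nonsplit
    (hGZ : ∀ (N : ℕ) [NeZero N] (W : WeierstrassCurve ℚ) (K : Type) [Field K] [NumberField K],
      gross_zagier N W K)
    (hKo : ∀ (N : ℕ) [NeZero N] (W : WeierstrassCurve ℚ) (K : Type) [Field K] [NumberField K],
      kolyvagin N W K)
    (hSk : Skinner2016.thmC_padicValRat_bsd_rank_zero)
    (hGZK : rank_eq_analyticRank_of_analyticRank_le_one) (hmod : hasEntireLFunction_rat)
    (hEP : ∀ (K : Type) [Field K] [NumberField K] (v : HeightOneSpectrum (𝓞 K)),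
      localEulerPoincareCharacteristic (v.adicCompletion K))
    (hPTs : ∀ (K : Type) [Field K] [NumberField K], poitouTate_selmerStructure_duality K)
    (hPT2 : ∀ (K : Type) [Field K] [NumberField K], poitouTate_sha_tateDual K)
    (hcd : fieldCdLE_two_of_numberField)
    (hSkA : thmA_charIdeal_multiplicative)
    (hJn : thm61_nonsplitMultiplicative) (hJs : thm61_splitMultiplicative)
    (hHn : exists_isMultCanonical) (hHs : exists_isSplitMultCanonical)
    (hD : thm1_padicBSD_rankOne_multiplicative) (hpar : nonempty_modularParametrizationData)
    (hX : ClassX11b W p) (hram : Ram W p) (htam : ¬ p ∣ W.tamagawaProduct)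
    (hns : ¬ W.HasSplitMultiplicativeReductionAtPrime p)
    (hReg : ClassClosure.RegulatorNonvanishingAt W p) :
    P2OpenInputOnTreeOddAt W p :=
  P2.openInputOnTreeOddAt_of_bsdp_of_locus_of_facts W p hGZ hKo hSk hGZK hmod hEP hPTs hPT2 hcd hX hram
    htam
    (ClassClosure.bsdp_of_leverLocus_of_regulatorNonvanishing W p hSkA hJn hJs hHn hHs hD hGZK hpar hX
      (ClassClosure.leverLocusAt_of_ram_of_nonsplit W p hram hns) hReg)

end Summit.BirchSwinnertonDyer.Rank1Residual.X11b

end
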